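/-
Copyright: the b2b-balaban T⁴-continuum CRUX team, row NE7b OWNER lineage `t4-ne7b-p1` (gen 126). Project licence.
-/
import Summits.QuantumFields.BalabanUV.T4Continuum.Spine.NE7b.SupZdPerturbedCovarianceKernel
import Summits.QuantumFields.BalabanUV.T4Continuum.Spine.NE7b.SupZdKernelResponseLipschitz
import Summits.QuantumFields.BalabanUV.T4Continuum.Spine.NE7b.SupZdPerturbedCoarseForm

/-!
# BLOCK COLUMNS SUPERPOSE, AND THE COUPLING SHIFTS THEM EXPLICITLY: on `ℤ^d`, for the `H + K` column, (§1) columns `Ψ_b` with block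
# profiles and decaying coefficients `m(b)` give an absolutely convergent `W = Σ′_bm(b)Ψ_b` of block profile solving `(H_{V,a} + K)W =
# m∘blk`; (§2) at two block-spin couplings `a, a′` (same `n, V, K`; `ε := a′ − a` of either sign, any size) the columns satisfy
# `Ψ^a_c = Ψ^{a′}_c + εΣ′_bT_a(b,c)Ψ^{a′}_b` — because `H_{V,a′} − H_{V,a} = εΠ` and `ΠΨ^a_c = T_a(blk ·, c)` IS the coarse matrix;
# the first half of «the coupling is an additive shift of the next-scale Hessian» ((259) finishes: `T_a = T_{a′} + εT_{a′}T_a`,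
# `N_{a′} = N_a + ε·1`) — the answer to the located a-uniformity audit for the Hessian (row NE7b, node U5c; (221)∕(234)∕(245) BY NAME;
# [folklore] — the operator form of «resistances add», [Balaban1982Higgs1] (2.13))

Cell `pub-balaban`, sub-cell `t4`, spine estimate NE7b (`T4WeightBudget.RelWeightBound`; the cell's OWN estimate — NOT PRINTED in
[Bałaban 1983–89], NOT PROVED).  Crux-route work under `Spine/NE7b/` by the row OWNER (`t4-ne7b-p1` gen 126, file (258)) under FREEZE
(0)'s crux-prover clause, on § [NE7bP1-G125-HANDOFF] NEXT (3)(a) («the a-UNIFORMITY AUDIT over `[a(1 − (n+1)^{−d}), a]`»: by (251)∕(252)∕(255)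
`k` composed block-spin steps are ONE step at the composed mesh with a composed coupling `c_k ∈ (a(1 − (n+1)^{−d}), a]`, and every headline
of the column quantifies its constants `∃ C …` AFTER fixing `a` — so uniformity in the coupling is not available by name); NOTHING of
Bałaban's is named as a Lean object, valued or asserted; no `T4Continuum/Support` leaf typed; no `def`, no notation (the columns at the two
couplings are ANY data with the displayed clauses — (216)∕(222)∕(246) supply them at each coupling, (237) (U) the uniqueness clause); zero
`sorry`.  Imports (BY NAME): the OWNER's (221) `…SupZdPerturbedCovarianceKernel` (`kernel_row_through_series` — a kernel row through a block
series, Fubini on `ℤ^d × ℤ^d`), (245) `…SupZdKernelResponseLipschitz` (`conv_term_le` — (214)'s no-loss convolution), (234)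
`…SupZdPerturbedCoarseForm` (`coarse_entry_le` — block means inherit the profile); through them (189) `summable_kernel_row`, (191)
`natAbs_sub_comm_sum`, (27) `mem_B` ∕ `sum_B_const`.

WHY (located).  The road couples the fine field to the block field softly, `H_{V,a} = (n+1)²(−Δ) + aΠ + V` with `Π` the projection onto
block-constant functions (`(aΠw)(p) = a(n+1)^{−d}Σ_{q∈B(blk p)}w(q)`), and iterating the step changes the coupling ((255)).  All of the column's
constants are functions of `(d, a, λ, Λ)` hidden behind `∃`, so an interval version by name would mean re-threading ≈ 60 files or building a
general-elliptic `L`-column.  NEITHER IS NEEDED FOR THE HESSIAN: since `H_{V,a′} − H_{V,a} = εΠ` and `ΠΨ^a_c = Σ_bT_a(b,c)𝟙_{B b}`, the column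
at coupling `a` solves, at coupling `a′`, the block-source equation with the coarse datum `δ_c + εT_a(·,c)`: `(H_{V,a′} + K)Ψ^a_c = 𝟙_{B c} +
εT_a(blk ·, c)`.  Superposing the `a′`-columns with the decaying coefficients `εT_a(·,c)` (§1: absolute convergence by (214)'s no-loss
convolution, the operator through the series termwise — finite stencil, finite block mean, the kernel row by (221)'s Fubini) produces
another bounded solution, so uniqueness of bounded solutions at `a′` ((237) (U)) gives the COLUMN IDENTITY (§2).  (259) takes block means
(`T_a = T_{a′} + εT_{a′}T_a`), multiplies by a decaying right inverse and re-associates (`T_{a′}(N_a + ε·1) = 1`), and concludes `N_{a′} = N_a + ε·1`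
by uniqueness of decaying right inverses.

WHAT IS PROVED ([folklore]; every mesh `n`, ANY `a, a′ : ℝ`, ANY `V`, kernel `|K(p,q)| ≤ εe^{−γ|p−q|₁}`):
* §1 **`column_superposition`** (columns `Ψ_b` of block profile `C_Ψe^{−μ|blk p − b|₁}` solving `(H_{V,a} + K)Ψ_b = 𝟙_{B b}`, coefficients
  `|m(b)| ≤ C_me^{−ν|b−c|₁}`, `0 < ν < μ` ⟹ `W = Σ′_bm(b)Ψ_b` converges absolutely, `|W(p)| ≤ C_mC_ΨK_{μ−ν}e^{−ν|blk p − c|₁}`, and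
  `(H_{V,a} + K)W = m∘blk` pointwise).
* §2 THE END **`coupling_shift_column`** (`b ↦ T_a(b,c)Ψ^{a′}_b(p)` summable and `Ψ^a_c(p) = Ψ^{a′}_c(p) + (a′−a)Σ′_bT_a(b,c)Ψ^{a′}_b(p)`, given
  (U) at `a′`).
* §3 toy.

HONEST (what this is NOT).  Kernel algebra for ANY objects with the displayed clauses; the existence of the columns at both couplings and
the uniqueness clause are INPUTS ((216)∕(222)∕(237)∕(246) at each coupling separately — each needs its own smallness of `K` relative to its
own constants); no constant of the `a′`-column is valued from the `a`-column here; scalar skeleton ((A3), NC-NE7b-α UNRULED); nothing of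
the torus; nothing of the covariant propagators of [B4]–[B6]; nothing of Bałaban's asserted.  BY-NAME EFFECT ON THE WALL: NONE.  NE7b NOT
PRINTED ∕ NOT PROVED; spine PROVED 0∕9; rung (B)+1 — the programme's measures remain FINITE-torus statements; NOT the mass gap, NOT Clay.
HONEST DEPENDENCY: continuum YM on T⁴ ⇐ BetaPertH ∧ nine spine estimates (0∕9 proved); BetaPertH ⇐ (D1) ∧ (D4) ∧ CAP+tail; G-an2-4
gates asym, D1 and NE2∕3∕4.
-/

set_option autoImplicit false

noncomputable section

namespace Summit.QuantumFields.BalabanUV.T4Continuum.NE7b.SupZdCouplingShiftColumn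

open Real Filter Topology
open Literature.MathematicalPhysics.QuantumFieldTheory.Balaban1983to89
open B6QGQLower276 (X e blk B mem_B sum_B_const)
open SupZdExponentialSums (summable_exp_l1 summable_kernel_row)
open SupZdCoarseForm (natAbs_sub_comm_sum)
open SupZdPerturbedCovarianceKernel (kernel_row_through_series)
open SupZdKernelResponseLipschitz (conv_term_le)
open SupZdPerturbedCoarseForm (coarse_entry_le)

variable {d : ℕ}

/-! ## §1. Superposition of block columns with decaying coefficients -/

/-- **SUPERPOSITION OF BLOCK COLUMNS**: columns `Ψ_b` with `|Ψ_b(p)| ≤ C_Ψe^{−μ|blk n p − b|₁}` solving `(H_{V,a} + K)Ψ_b = 𝟙_{B n b}`, and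
coefficients `|m(b)| ≤ C_me^{−ν|b − c|₁}` (`0 < ν < μ`) ⟹ for every `p` the series `Σ′_bm(b)Ψ_b(p)` converges absolutely,
`|Σ′_bm(b)Ψ_b(p)| ≤ C_mC_ΨK_{μ−ν}e^{−ν|blk n p − c|₁}`, and `(H_{V,a} + K)(Σ′_bm(b)Ψ_b) = m∘blk` pointwise — the finite stencil and block mean
through the series term by term, the kernel row by (221)'s Fubini. [folklore] -/
theorem column_superposition (n : ℕ) (a : ℝ) {ε γ μ ν CΨ Cm : ℝ} (hε : 0 ≤ ε) (hγ : 0 < γ) (hν : 0 < ν) (hνμ : ν < μ)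
    (V : X d → ℝ) (K : X d → X d → ℝ) (hK : ∀ p q, |K p q| ≤ ε * exp (-(γ * ∑ i, (((p i - q i).natAbs : ℕ) : ℝ))))
    (Ψ : X d → X d → ℝ) (hΨd : ∀ b p, |Ψ b p| ≤ CΨ * exp (-(μ * ∑ i, (((blk n p i - b i).natAbs : ℕ) : ℝ))))
    (hΨ : ∀ b p, ((n : ℝ) + 1) ^ 2 * ∑ μ', (2 * Ψ b p - Ψ b (p + e μ') - Ψ b (p - e μ'))
        + a / ((n : ℝ) + 1) ^ d * ∑ q ∈ B n (blk n p), Ψ b q + V p * Ψ b p + ∑' q : X d, K p q * Ψ b q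
          = if blk n p = b then 1 else 0)
    (c : X d) (m : X d → ℝ) (hm : ∀ b, |m b| ≤ Cm * exp (-(ν * ∑ i, (((b i - c i).natAbs : ℕ) : ℝ)))) :
    (∀ p, Summable fun b : X d => m b * Ψ b p) ∧
    (∀ p, |∑' b : X d, m b * Ψ b p| ≤ Cm * CΨ * (2 * (1 - exp (-(μ - ν)))⁻¹) ^ d
        * exp (-(ν * ∑ i, (((blk n p i - c i).natAbs : ℕ) : ℝ)))) ∧
    (∀ p, ((n : ℝ) + 1) ^ 2 * ∑ μ', (2 * (∑' b : X d, m b * Ψ b p) - (∑' b : X d, m b * Ψ b (p + e μ'))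
          - (∑' b : X d, m b * Ψ b (p - e μ')))
        + a / ((n : ℝ) + 1) ^ d * ∑ q ∈ B n (blk n p), (∑' b : X d, m b * Ψ b q)
        + V p * (∑' b : X d, m b * Ψ b p) + ∑' q : X d, K p q * (∑' b : X d, m b * Ψ b q) = m (blk n p)) := by
  classical
  have hμ : 0 < μ := hν.trans hνμ
  have hCΨ : 0 ≤ CΨ := by
    have h := (abs_nonneg _).trans (hΨd c 0); exact le_of_mul_le_mul_right (by rw [zero_mul]; exact h) (exp_pos _)
  have hCm : 0 ≤ Cm := by
    have h := (abs_nonneg _).trans (hm c); exact le_of_mul_le_mul_right (by rw [zero_mul]; exact h) (exp_pos _)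
  have hΨb : ∀ b q, |Ψ b q| ≤ CΨ := fun b q =>
    (hΨd b q).trans (mul_le_of_le_one_right hCΨ (exp_le_one_iff.2 (neg_nonpos.2 (by positivity))))
  -- absolute convergence and the profile: (214)'s no-loss convolution
  have hconv := fun p => conv_term_le (d := d) hν.le hνμ c (blk n p) m (fun b => Ψ b p) hm (fun b => hΨd b p)
  have hs : ∀ p, Summable fun b : X d => m b * Ψ b p := fun p => (hconv p).1
  refine ⟨hs, fun p => (hconv p).2, fun p => ?_⟩
  -- the kernel row through the series ((221) §1)
  have hm' : ∀ b, |m b| ≤ Cm * exp (-(ν * ∑ i, (((c i - b i).natAbs : ℕ) : ℝ))) := fun b => by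
    rw [natAbs_sub_comm_sum]; exact hm b
  obtain ⟨hSK, hKrow⟩ := kernel_row_through_series (d := d) hε hγ hν hCm hCΨ K hK c m Ψ hm' hΨb p
  -- termwise: the `b`-th column contributes `m(b)𝟙[blk p = b]`
  have hpt : ∑' b : X d, (((n : ℝ) + 1) ^ 2 * ∑ μ', (2 * (m b * Ψ b p) - m b * Ψ b (p + e μ') - m b * Ψ b (p - e μ'))
      + a / ((n : ℝ) + 1) ^ d * ∑ q ∈ B n (blk n p), m b * Ψ b q + V p * (m b * Ψ b p) + m b * ∑' q : X d, K p q * Ψ b q)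
      = ∑' b : X d, m b * (if blk n p = b then (1 : ℝ) else 0) := by
    refine tsum_congr fun b => ?_
    rw [← hΨ b p]
    have e2 : ∑ μ', (2 * (m b * Ψ b p) - m b * Ψ b (p + e μ') - m b * Ψ b (p - e μ'))
        = m b * ∑ μ', (2 * Ψ b p - Ψ b (p + e μ') - Ψ b (p - e μ')) := by
      rw [Finset.mul_sum]; exact Finset.sum_congr rfl fun μ' _ => by ring
    rw [e2, ← Finset.mul_sum]
    ring
  have hind : ∑' b : X d, m b * (if blk n p = b then (1 : ℝ) else 0) = m (blk n p) := by
    rw [tsum_eq_single (blk n p) (fun b hb => by rw [if_neg (Ne.symm hb), mul_zero]), if_pos rfl, mul_one]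
  -- summability of the pieces
  have hS1 : ∀ μ' : Fin d, Summable fun b : X d => 2 * (m b * Ψ b p) - m b * Ψ b (p + e μ') - m b * Ψ b (p - e μ') :=
    fun μ' => (((hs p).mul_left 2).sub (hs (p + e μ'))).sub (hs (p - e μ'))
  have hS1s : Summable fun b : X d => ∑ μ', (2 * (m b * Ψ b p) - m b * Ψ b (p + e μ') - m b * Ψ b (p - e μ')) :=
    summable_sum fun μ' _ => hS1 μ'
  have hS2 : Summable fun b : X d => ∑ q ∈ B n (blk n p), m b * Ψ b q := summable_sum fun q _ => hs q
  have hT1 : ∑' b : X d, ∑ μ', (2 * (m b * Ψ b p) - m b * Ψ b (p + e μ') - m b * Ψ b (p - e μ'))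
      = ∑ μ', (2 * (∑' b : X d, m b * Ψ b p) - (∑' b : X d, m b * Ψ b (p + e μ')) - (∑' b : X d, m b * Ψ b (p - e μ'))) := by
    rw [Summable.tsum_finsetSum fun μ' _ => hS1 μ']
    refine Finset.sum_congr rfl fun μ' _ => ?_
    rw [(((hs p).mul_left 2).sub (hs (p + e μ'))).tsum_sub (hs (p - e μ')), ((hs p).mul_left 2).tsum_sub (hs (p + e μ')),
      (hs p).tsum_mul_left 2]
  have hT2 : ∑' b : X d, ∑ q ∈ B n (blk n p), m b * Ψ b q = ∑ q ∈ B n (blk n p), ∑' b : X d, m b * Ψ b q :=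
    Summable.tsum_finsetSum fun q _ => hs q
  have hmain : ∑' b : X d, (((n : ℝ) + 1) ^ 2 * ∑ μ', (2 * (m b * Ψ b p) - m b * Ψ b (p + e μ') - m b * Ψ b (p - e μ'))
      + a / ((n : ℝ) + 1) ^ d * ∑ q ∈ B n (blk n p), m b * Ψ b q + V p * (m b * Ψ b p) + m b * ∑' q : X d, K p q * Ψ b q)
      = ((n : ℝ) + 1) ^ 2 * ∑' b : X d, ∑ μ', (2 * (m b * Ψ b p) - m b * Ψ b (p + e μ') - m b * Ψ b (p - e μ'))
        + a / ((n : ℝ) + 1) ^ d * ∑' b : X d, ∑ q ∈ B n (blk n p), m b * Ψ b q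
        + V p * ∑' b : X d, m b * Ψ b p + ∑' b : X d, m b * ∑' q : X d, K p q * Ψ b q := by
    rw [Summable.tsum_add (((hS1s.mul_left _).add (hS2.mul_left _)).add ((hs p).mul_left _)) hSK,
      Summable.tsum_add ((hS1s.mul_left _).add (hS2.mul_left _)) ((hs p).mul_left _),
      Summable.tsum_add (hS1s.mul_left _) (hS2.mul_left _), hS1s.tsum_mul_left (((n : ℝ) + 1) ^ 2),
      hS2.tsum_mul_left (a / ((n : ℝ) + 1) ^ d), (hs p).tsum_mul_left (V p)]
  have hHh : ((n : ℝ) + 1) ^ 2 * ∑ μ', (2 * (∑' b : X d, m b * Ψ b p) - (∑' b : X d, m b * Ψ b (p + e μ'))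
          - (∑' b : X d, m b * Ψ b (p - e μ')))
        + a / ((n : ℝ) + 1) ^ d * ∑ q ∈ B n (blk n p), (∑' b : X d, m b * Ψ b q) + V p * (∑' b : X d, m b * Ψ b p)
        + ∑' q : X d, K p q * ∑' b : X d, m b * Ψ b q
        = ∑' b : X d, m b * (if blk n p = b then (1 : ℝ) else 0) := by
    rw [← hpt, hmain, hT1, hT2, hKrow]
  rw [hHh, hind]

/-! ## §2. The column identity between two couplings -/

/-- **THE COUPLING SHIFT OF THE BLOCK COLUMNS**: columns `Ψ` at coupling `a` and `Ψ′` at coupling `a′` (both of block profile at rate `μ`,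
same `n, V, K`) and uniqueness of bounded solutions of `(H_{V,a′} + K)u = f` ⟹ for all `c, p`:
`Ψ_c(p) = Ψ′_c(p) + (a′ − a)·Σ′_bT_a(b,c)Ψ′_b(p)`, `T_a(b,c) = (n+1)^{−d}Σ_{q∈B n b}Ψ_c(q)` — both sides are bounded solutions of the
`a′`-equation with the source `𝟙_{B c} + (a′ − a)T_a(blk ·, c)`, since `H_{V,a′} − H_{V,a} = (a′ − a)Π` and `ΠΨ_c = T_a(blk ·, c)`. [folklore] -/
theorem coupling_shift_column (n : ℕ) (a a' : ℝ) {ε γ μ ν CΨ CΨ' : ℝ} (hε : 0 ≤ ε) (hγ : 0 < γ) (hν : 0 < ν) (hνμ : ν < μ)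
    (V : X d → ℝ) (K : X d → X d → ℝ) (hK : ∀ p q, |K p q| ≤ ε * exp (-(γ * ∑ i, (((p i - q i).natAbs : ℕ) : ℝ))))
    (Ψ : X d → X d → ℝ) (hΨd : ∀ c p, |Ψ c p| ≤ CΨ * exp (-(μ * ∑ i, (((blk n p i - c i).natAbs : ℕ) : ℝ))))
    (hΨ : ∀ c p, ((n : ℝ) + 1) ^ 2 * ∑ μ', (2 * Ψ c p - Ψ c (p + e μ') - Ψ c (p - e μ'))
        + a / ((n : ℝ) + 1) ^ d * ∑ q ∈ B n (blk n p), Ψ c q + V p * Ψ c p + ∑' q : X d, K p q * Ψ c q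
          = if blk n p = c then 1 else 0)
    (Ψ' : X d → X d → ℝ) (hΨ'd : ∀ c p, |Ψ' c p| ≤ CΨ' * exp (-(μ * ∑ i, (((blk n p i - c i).natAbs : ℕ) : ℝ))))
    (hΨ' : ∀ c p, ((n : ℝ) + 1) ^ 2 * ∑ μ', (2 * Ψ' c p - Ψ' c (p + e μ') - Ψ' c (p - e μ'))
        + a' / ((n : ℝ) + 1) ^ d * ∑ q ∈ B n (blk n p), Ψ' c q + V p * Ψ' c p + ∑' q : X d, K p q * Ψ' c q
          = if blk n p = c then 1 else 0)
    (hU : ∀ (f : X d → ℝ) (Mf : ℝ), (∀ p, |f p| ≤ Mf) → ∀ (u v : X d → ℝ) (Bu Bv : ℝ), (∀ p, |u p| ≤ Bu) → (∀ p, |v p| ≤ Bv) →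
        (∀ p, ((n : ℝ) + 1) ^ 2 * ∑ μ', (2 * u p - u (p + e μ') - u (p - e μ'))
          + a' / ((n : ℝ) + 1) ^ d * ∑ q ∈ B n (blk n p), u q + V p * u p + ∑' q : X d, K p q * u q = f p) →
        (∀ p, ((n : ℝ) + 1) ^ 2 * ∑ μ', (2 * v p - v (p + e μ') - v (p - e μ'))
          + a' / ((n : ℝ) + 1) ^ d * ∑ q ∈ B n (blk n p), v q + V p * v p + ∑' q : X d, K p q * v q = f p) →
        ∀ p, u p = v p)
    (c p : X d) :
    Summable (fun b : X d => ((((n : ℝ) + 1) ^ d)⁻¹ * ∑ q ∈ B n b, Ψ c q) * Ψ' b p) ∧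
    Ψ c p = Ψ' c p + (a' - a) * ∑' b : X d, ((((n : ℝ) + 1) ^ d)⁻¹ * ∑ q ∈ B n b, Ψ c q) * Ψ' b p := by
  classical
  have hμ : 0 < μ := hν.trans hνμ
  have hvol : (0 : ℝ) < ((n : ℝ) + 1) ^ d := by positivity
  have hS0 : ∀ b c' : X d, (0 : ℝ) ≤ ∑ i, (((b i - c' i).natAbs : ℕ) : ℝ) := fun _ _ => by positivity
  have hCΨ : 0 ≤ CΨ := by
    have h := (abs_nonneg _).trans (hΨd c 0); exact le_of_mul_le_mul_right (by rw [zero_mul]; exact h) (exp_pos _)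
  have hCΨ' : 0 ≤ CΨ' := by
    have h := (abs_nonneg _).trans (hΨ'd c 0); exact le_of_mul_le_mul_right (by rw [zero_mul]; exact h) (exp_pos _)
  -- the coarse column `T_a(·, c)` has a coarse profile at rate `μ`, hence at rate `ν`
  obtain ⟨T, hT⟩ : ∃ T : X d → ℝ, ∀ b, T b = (((n : ℝ) + 1) ^ d)⁻¹ * ∑ q ∈ B n b, Ψ c q := ⟨_, fun _ => rfl⟩
  have hTd : ∀ b, |T b| ≤ CΨ * exp (-(ν * ∑ i, (((b i - c i).natAbs : ℕ) : ℝ))) := fun b => by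
    rw [hT]
    exact (coarse_entry_le n Ψ c (hΨd c) b).trans
      (mul_le_mul_of_nonneg_left (exp_le_exp.2 (neg_le_neg (mul_le_mul_of_nonneg_right hνμ.le (hS0 _ _)))) hCΨ)
  -- the superposition at coupling `a′`
  obtain ⟨hs, hWd, hWeq⟩ := column_superposition n a' hε hγ hν hνμ V K hK Ψ' hΨ'd hΨ' c T hTd
  simp only [hT] at hs
  refine ⟨hs p, ?_⟩
  -- both sides solve the `a′`-equation with the source `𝟙_{B c} + (a′ − a)T(blk ·)`
  obtain ⟨u, hu⟩ : ∃ u : X d → ℝ, ∀ q, u q = Ψ' c q + (a' - a) * ∑' b : X d, T b * Ψ' b q := ⟨_, fun _ => rfl⟩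
  have hTblk : ∀ q, (((n : ℝ) + 1) ^ d)⁻¹ * ∑ q' ∈ B n (blk n q), Ψ c q' = T (blk n q) := fun q => by rw [hT]
  -- `Ψ_c` solves it: `H_{a′} = H_a + (a′ − a)Π`
  have h1 : ∀ q, ((n : ℝ) + 1) ^ 2 * ∑ μ', (2 * Ψ c q - Ψ c (q + e μ') - Ψ c (q - e μ'))
      + a' / ((n : ℝ) + 1) ^ d * ∑ q' ∈ B n (blk n q), Ψ c q' + V q * Ψ c q + ∑' q' : X d, K q q' * Ψ c q'
      = (if blk n q = c then 1 else 0) + (a' - a) * T (blk n q) := by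
    intro q
    rw [← hΨ c q, ← hTblk q, div_eq_mul_inv, div_eq_mul_inv]
    ring
  -- `u` solves it: `Ψ′_c` gives `𝟙_{B c}`, the superposition gives `(a′ − a)T(blk ·)` (§1)
  have hsT : ∀ q, Summable fun b : X d => T b * Ψ' b q := fun q => by simp only [hT]; exact hs q
  have h2 : ∀ q, ((n : ℝ) + 1) ^ 2 * ∑ μ', (2 * u q - u (q + e μ') - u (q - e μ'))
      + a' / ((n : ℝ) + 1) ^ d * ∑ q' ∈ B n (blk n q), u q' + V q * u q + ∑' q' : X d, K q q' * u q'
      = (if blk n q = c then 1 else 0) + (a' - a) * T (blk n q) := by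
    intro q
    have hW := hWeq q
    have hP := hΨ' c q
    -- the kernel row is linear on `u = Ψ′_c + (a′−a)W`
    have hΨ'b : ∀ q', |Ψ' c q'| ≤ CΨ' := fun q' =>
      (hΨ'd c q').trans (mul_le_of_le_one_right hCΨ' (exp_le_one_iff.2 (neg_nonpos.2 (by positivity))))
    have hWb : ∀ q', |∑' b : X d, T b * Ψ' b q'| ≤ CΨ * CΨ' * (2 * (1 - exp (-(μ - ν)))⁻¹) ^ d := fun q' =>
      (hWd q').trans (mul_le_of_le_one_right (by
        have hK0 : 0 ≤ (2 * (1 - exp (-(μ - ν)))⁻¹) ^ d :=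
          pow_nonneg (mul_nonneg zero_le_two (inv_nonneg.2 (sub_nonneg.2 (exp_le_one_iff.2 (by linarith))))) d
        positivity) (exp_le_one_iff.2 (neg_nonpos.2 (by positivity))))
    have hsK1 : Summable fun q' : X d => K q q' * Ψ' c q' := summable_kernel_row hγ K hK _ hΨ'b q
    have hsK2 : Summable fun q' : X d => K q q' * ∑' b : X d, T b * Ψ' b q' := summable_kernel_row hγ K hK _ hWb q
    have hKu : ∑' q' : X d, K q q' * u q' = ∑' q' : X d, K q q' * Ψ' c q' + (a' - a) * ∑' q' : X d, K q q' * ∑' b : X d, T b * Ψ' b q' := by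
      rw [← tsum_mul_left, ← hsK1.tsum_add (hsK2.mul_left _)]
      exact tsum_congr fun q' => by rw [hu]; ring
    have e1 : ∑ μ', (2 * u q - u (q + e μ') - u (q - e μ'))
        = ∑ μ', (2 * Ψ' c q - Ψ' c (q + e μ') - Ψ' c (q - e μ'))
          + (a' - a) * ∑ μ', (2 * (∑' b : X d, T b * Ψ' b q) - (∑' b : X d, T b * Ψ' b (q + e μ'))
            - (∑' b : X d, T b * Ψ' b (q - e μ'))) := by
      rw [Finset.mul_sum, ← Finset.sum_add_distrib]
      exact Finset.sum_congr rfl fun μ' _ => by rw [hu, hu, hu]; ring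
    have e2 : ∑ q' ∈ B n (blk n q), u q' = ∑ q' ∈ B n (blk n q), Ψ' c q' + (a' - a) * ∑ q' ∈ B n (blk n q), ∑' b : X d, T b * Ψ' b q' := by
      rw [Finset.mul_sum, ← Finset.sum_add_distrib]
      exact Finset.sum_congr rfl fun q' _ => by rw [hu]
    rw [hKu, e1, e2, hu q, ← hP, ← hW, div_eq_mul_inv]
    ring
  -- bounds on the source and on both solutions
  have hCΨb : ∀ q, |Ψ c q| ≤ CΨ := fun q =>
    (hΨd c q).trans (mul_le_of_le_one_right hCΨ (exp_le_one_iff.2 (neg_nonpos.2 (by positivity))))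
  have hTb : ∀ b, |T b| ≤ CΨ := fun b =>
    (hTd b).trans (mul_le_of_le_one_right hCΨ (exp_le_one_iff.2 (neg_nonpos.2 (by positivity))))
  have hfb : ∀ q, |(if blk n q = c then (1 : ℝ) else 0) + (a' - a) * T (blk n q)| ≤ 1 + |a' - a| * CΨ := fun q => by
    refine (abs_add_le _ _).trans (add_le_add ?_ ?_)
    · split_ifs <;> simp
    · rw [abs_mul]; exact mul_le_mul_of_nonneg_left (hTb _) (abs_nonneg _)
  have hub : ∀ q, |u q| ≤ CΨ' + |a' - a| * (CΨ * CΨ' * (2 * (1 - exp (-(μ - ν)))⁻¹) ^ d) := by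
    intro q
    rw [hu]
    refine (abs_add_le _ _).trans (add_le_add ((hΨ'd c q).trans (mul_le_of_le_one_right hCΨ'
      (exp_le_one_iff.2 (neg_nonpos.2 (by positivity))))) ?_)
    rw [abs_mul]
    refine mul_le_mul_of_nonneg_left ((hWd q).trans (mul_le_of_le_one_right ?_
      (exp_le_one_iff.2 (neg_nonpos.2 (by positivity))))) (abs_nonneg _)
    have hK0 : 0 ≤ (2 * (1 - exp (-(μ - ν)))⁻¹) ^ d :=
      pow_nonneg (mul_nonneg zero_le_two (inv_nonneg.2 (sub_nonneg.2 (exp_le_one_iff.2 (by linarith))))) d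
    positivity
  have hmain := hU _ _ hfb (Ψ c) u _ _ hCΨb hub h1 h2 p
  rw [hmain, hu]
  simp only [hT]

/-! ## §3. Toy -/

/-- Toy (`d = 1`): the coarse datum `δ_c + (a′ − a)T_a(·, c)` of §2's `a′`-equation reduces to `δ_c` when the couplings agree. -/
example (T : X 1 → ℝ) (a : ℝ) (c b : X 1) :
    (if b = c then (1 : ℝ) else 0) + (a - a) * T b = if b = c then 1 else 0 := by
  rw [sub_self, zero_mul, add_zero]

end Summit.QuantumFields.BalabanUV.T4Continuum.NE7b.SupZdCouplingShiftColumn
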